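import Literature.AlgebraicGeometry.Frobenioids.Thm49CompatAssembly
import Literature.AlgebraicGeometry.Frobenioids.Thm49CompatWeak
import Literature.AlgebraicGeometry.Frobenioids.Thm49RightEqLeftAssemblyWeak
import Literature.AlgebraicGeometry.Frobenioids.Thm49TwinPrimaryExistenceWeak
import Literature.AlgebraicGeometry.Frobenioids.Thm42SubWeakBasic
import HarnessLib

/-!
# [FrdI] Theorem 4.9 WITH its compatibility clause at the perfections — ASSEMBLY in the WEAK setting
# (weakly perf-factorial divisor monoids), unconditional over print's hypotheses

Mochizuki, *The geometry of Frobenioids I: the general theory*, Kyushu J. Math. **62** (2008)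
293–400, §4, Theorem 4.9, statement p. 88 l. 33 – p. 89 l. 2, proof p. 89 l. 3 – p. 90 l. 54
[cite: MochizukiFrdI2008, Thm. 4.9 p.88].

PROOF-ONLY file (cell abc-iut, layer L1, seat abc-iut-L1-t14; row «C411iii/iv-WEAK» = the [FrdI] Thm. 4.9 /
Cor. 4.11 (iii)(iv) chain over `IsPerfFactorialWeak`, block (T3)). WEAK-HYPOTHESIS TWINS of the five
`T42.Setting`-typed theorems of `Thm49CompatAssembly.lean` (seat abc-iut-w4-d105), now over
`FrdI.T42.SettingWeak` (`Thm42SubWeak.lean`; "`Φ_i` perf-factorial" weakened to "`Φ_i` weakly perf-factorial",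
Def. 2.4 (i) (a)(b)(c) + (d_ord) + (d_res); cell finding F-L2d2-1): `FrdI.T49.exists_thm49_compat_of_cover_weak`,
`exists_thm49_compat_of_isRational_weak`, `exists_thm49_compat_of_isRational_of_nonDilating_weak`,
`exists_thm49_compat_perfect_weak`, `exists_thm49_compat_perfect_primarySupp_weak` — Thm. 4.9 with its
compatibility clause `Thm49_compat` at the perfections, for Frobenioids of perfect and isotropic type with
WEAKLY perf-factorial `Φ_i`, `Φ₂` non-dilating, every universally Div-Frobenius-trivial object rational.
Where the strong theorems take row T49-L02 `SufficesRightEqLeft` as a hypothesis (`h`, `hL02`; discharged in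
the strong tree by `sufficesRightEqLeft_holds`), the weak twins consume its weak PROOF
`sufficesRightEqLeft_holds_weak` through `exists_thm49_compat_of_sufficesRightEqLeft_weak` (`Thm49CompatWeak.lean`),
so that binder disappears. Other inputs BY NAME: `exists_primesEquiv_rightEqLeftAt_of_cover_weak`
(`Thm49RightEqLeftAssemblyWeak.lean`), `invDiv_map_mem_carrier_of_clauseB_weak`, seat abc-iut-L1-t11's
binder-typed row T49-L07 `FrdI.T49.exists_twinPrimary_pair_of_isStrictlyRational_weak`
(`Thm49TwinPrimaryExistenceWeak.lean`, fed the fields of the setting), `SettingWeak.isPrimaryPreStep_map /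
…_inverse_map / isDivIdentity_map / divEquivalent_map` (`Thm42SubWeakBasic.lean`). Proofs otherwise verbatim.
No new definitions; nothing of the paper restated or strengthened; nothing here is specific to the abc programme
and no side is taken on [IUTchIII] Cor. 3.12.
-/

namespace Literature.AlgebraicGeometry.Frobenioids

open CategoryTheory Opposite


namespace FrdI.T49

universe w v v' u u'

variable {D₁ : Type u} [Category.{v} D₁] {Φ₁ : D₁ᵒᵖ ⥤ CommMonCat.{w}} {C₁ : Type u'} [Category.{v'} C₁]
  {D₂ : Type u} [Category.{v} D₂] {Φ₂ : D₂ᵒᵖ ⥤ CommMonCat.{w}} {C₂ : Type u'} [Category.{v'} C₂]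

/-- (WEAK setting: `T42.SettingWeak`, weakly perf-factorial `Φ_i`; twin of the strong theorem of the same name without `_weak`; row T49-L02 consumed as `sufficesRightEqLeft_holds_weak`.) **Thm. 4.9 with its compatibility clause, assembled at the level of the `T42.SettingWeak`** (perfect and
isotropic type, "after passing to perfections", p. 89 l. 38) modulo row T49-L02 (`SufficesRightEqLeft`,
hypothesis): from Thm. 4.2 (i) ("`Ψ`, `Ψ⁻¹` preserve primary steps"; Div-identity endomorphisms of
Div-Frobenius-trivial objects, row T42-L11), a class `P` of objects ("strictly rational") each carrying, at
every prime, twin-primary steps mapped by `Ψ` to twin-primary steps (rows T49-L07/L08′) and covering every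
universally Div-Frobenius-trivial object by a pull-back morphism ("`A` rational", row T49-L05), one obtains
THE `Ψ^Prime` of Thm. 4.2 (ii) (clauses (a), (b)) together with an isomorphism of functors `Ψ^Φ : Φ₁ ⥲ Φ₂`
over `Ψ` computing `Div(Ψ φ) = Ψ^Φ_A(Div φ)` on pre-steps and COMPATIBLE with `Ψ^Prime` (the typed
`Thm49_compat`). Composition of `FrdI.T49.exists_primesEquiv_rightEqLeftAt_of_cover_weak` (seat abc-iut-w4-d099),
`invDiv_map_mem_carrier_of_clauseB_weak` and `exists_thm49_compat_of_sufficesRightEqLeft_weak`.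
[cite: MochizukiFrdI2008, Thm. 4.9 p.89] -/
theorem exists_thm49_compat_of_cover_weak
    (F₁ : C₁ ⥤ ElemFrobenioid Φ₁) (F₂ : C₂ ⥤ ElemFrobenioid Φ₂) (Ψ : C₁ ≌ C₂) (S : T42.SettingWeak F₁ F₂ Ψ)
    (hprim : ∀ ⦃X Y : C₁⦄ (φ : X ⟶ Y), PreFrobenioid.IsPrimaryPreStep F₁ φ →
      PreFrobenioid.IsPrimaryPreStep F₂ (Ψ.functor.map φ))
    (hprim' : ∀ ⦃X Y : C₂⦄ (φ : X ⟶ Y), PreFrobenioid.IsPrimaryPreStep F₂ φ →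
      PreFrobenioid.IsPrimaryPreStep F₁ (Ψ.inverse.map φ))
    (hdivid : ∀ ⦃A : C₁⦄, PreFrobenioid.IsDivFrobeniusTrivial F₁ A → ∀ α : A ⟶ A,
      PreFrobenioid.IsDivIdentity F₁ α → PreFrobenioid.IsDivIdentity F₂ (Ψ.functor.map α))
    (P : C₁ → Prop)
    (htwin : ∀ ⦃A' : C₁⦄, P A' → ∀ 𝔮 : Primes (Φ₁.obj (op (PreFrobenioid.baseObj F₁ A'))),
      ∃ (B C' : C₁) (β : A' ⟶ B) (γ : C' ⟶ A'), IsTwinPrimary F₁ β γ ∧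
        PreFrobenioid.Div F₁ β ∈ 𝔮.carrier ∧ IsTwinPrimary F₂ (Ψ.functor.map β) (Ψ.functor.map γ))
    (hcover : ∀ ⦃A : C₁⦄, PreFrobenioid.IsUniversallyDivFrobeniusTrivial F₁ A →
      ∃ (A' : C₁) (ψ : A' ⟶ A), PreFrobenioid.IsPullbackMorphism F₁ ψ ∧ P A') :
    ∃ (E : PreFrobenioidData.DivisorMonoidIsoOver (PreFrobenioidData.ofFunctor Φ₁ F₁)
        (PreFrobenioidData.ofFunctor Φ₂ F₂) Ψ)
      (e : ∀ A : C₁, Primes (Φ₁.obj (op (PreFrobenioid.baseObj F₁ A))) ≃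
        Primes (Φ₂.obj (op (PreFrobenioid.baseObj F₂ (Ψ.functor.obj A))))),
      (∀ (A : C₁) (𝔭 : Primes (Φ₁.obj (op (PreFrobenioid.baseObj F₁ A)))),
        (∀ ⦃B : C₁⦄ (φ : A ⟶ B), PreFrobenioid.IsCoAngularPreStep F₁ φ →
            (PreFrobenioid.Div F₁ φ ∈ 𝔭.submonoid ↔
              PreFrobenioid.Div F₂ (Ψ.functor.map φ) ∈ (e A 𝔭).submonoid)) ∧
        ∀ ⦃B : C₁⦄ (ψ : B ⟶ A), PreFrobenioid.IsCoAngularPreStep F₁ ψ →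
          ((∃ y ∈ 𝔭.submonoid, pull Φ₁ (PreFrobenioid.Base F₁ ψ) y = PreFrobenioid.Div F₁ ψ) ↔
            ∃ y ∈ (e A 𝔭).submonoid, pull Φ₂ (PreFrobenioid.Base F₂ (Ψ.functor.map ψ)) y =
              PreFrobenioid.Div F₂ (Ψ.functor.map ψ))) ∧
      (∀ ⦃A B : C₁⦄ (φ : A ⟶ B), PreFrobenioid.IsPreStep F₁ φ →
          E.iso A (PreFrobenioid.Div F₁ φ) = PreFrobenioid.Div F₂ (Ψ.functor.map φ)) ∧
      Literature.AlgebraicGeometry.Frobenioids.PreFrobenioidData.Thm49_compat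
        (PreFrobenioidData.ofFunctor Φ₁ F₁) (PreFrobenioidData.ofFunctor Φ₂ F₂) Ψ E e := by
  obtain ⟨e, he, hRL⟩ := exists_primesEquiv_rightEqLeftAt_of_cover_weak S hprim hprim' hdivid P htwin hcover
  obtain ⟨E, hE, hc⟩ := exists_thm49_compat_of_sufficesRightEqLeft_weak F₁ F₂ Ψ S e
    (fun A 𝔭 => (he A 𝔭).1) hRL
  exact ⟨E, e, he, hE, hc⟩

/-! ## Part 2: print's cover ("strictly rational", Def. 4.5 (ii)) and the Thm. 4.2 inputs discharged -/

variable {F₁ : C₁ ⥤ ElemFrobenioid Φ₁} {F₂ : C₂ ⥤ ElemFrobenioid Φ₂} {Ψ : C₁ ≌ C₂}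

set_option backward.isDefEq.respectTransparency false in
/-- (WEAK setting: `T42.SettingWeak`, weakly perf-factorial `Φ_i`; twin of the strong theorem of the same name without `_weak`; row T49-L02 consumed as `sufficesRightEqLeft_holds_weak`.) **[FrdI] Thm. 4.9 (with compatibility) at the perfections, rational cover, modulo row T49-L02**
(p. 89 l. 38 – p. 90 l. 54): in the `T42.SettingWeak`, with `C₁` admitting the birationalization squares of
Prop. 4.4, a support predicate `Supp` obeying the support axiom of Def. 2.4 (i)(d), every universally
Div-Frobenius-trivial object of `C₁` rational (Def. 4.5 (ii)), and the two Thm. 4.2 inputs "`Ψ` preserves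
the Div-identity endomorphisms of Div-Frobenius-trivial objects" and "`Ψ` preserves Div-equivalent pairs of
base-isomorphisms" as named hypotheses, row T49-L02 `SufficesRightEqLeft` yields THE `Ψ^Prime` (clauses
(a), (b) of Thm. 4.2 (ii)) and an isomorphism of functors `Ψ^Φ : Φ₁ ⥲ Φ₂` over `Ψ` computing `Div(Ψ φ)` on
pre-steps and compatible with `Ψ^Prime` (`Thm49_compat`). [cite: MochizukiFrdI2008, Thm. 4.9 p.89] -/
theorem exists_thm49_compat_of_isRational_weak
    (S : T42.SettingWeak F₁ F₂ Ψ)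
    (hdivid : ∀ ⦃A : C₁⦄, PreFrobenioid.IsDivFrobeniusTrivial F₁ A → ∀ α : A ⟶ A,
      PreFrobenioid.IsDivIdentity F₁ α → PreFrobenioid.IsDivIdentity F₂ (Ψ.functor.map α))
    (hdiveq : ∀ ⦃X Y : C₁⦄ (φ ψ : X ⟶ Y), PreFrobenioid.IsBaseIso F₁ φ → PreFrobenioid.IsBaseIso F₁ ψ →
      PreFrobenioid.DivEquivalent F₁ φ ψ →
        PreFrobenioid.DivEquivalent F₂ (Ψ.functor.map φ) (Ψ.functor.map ψ))
    (hsq : PreFrobenioid.HasBiratSquares F₁)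
    (Supp : ∀ {X : D₁}, (PreFrobenioidData.ofFunctor Φ₁ F₁).Mon X →
      Primes ((PreFrobenioidData.ofFunctor Φ₁ F₁).Mon X) → Prop)
    (hSupp : ∀ (X : D₁) (a : Φ₁.obj (op X)) (𝔭 : Primes (Φ₁.obj (op X))),
      Supp a 𝔭 ↔ ∃ (a₀ : Φ₁.obj (op X)) (h₀ : IsPrimary a₀),
        Quotient.mk (primarySetoid _) ⟨a₀, h₀⟩ = 𝔭 ∧ Precsim a₀ a)
    (hrat : ∀ ⦃A : C₁⦄, PreFrobenioid.IsUniversallyDivFrobeniusTrivial F₁ A →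
      PreFrobenioidData.IsRational (PreFrobenioid.biratData S.isFrobenioid₁ hsq) Supp A) :
    ∃ (E : PreFrobenioidData.DivisorMonoidIsoOver (PreFrobenioidData.ofFunctor Φ₁ F₁)
        (PreFrobenioidData.ofFunctor Φ₂ F₂) Ψ)
      (e : ∀ A : C₁, Primes (Φ₁.obj (op (PreFrobenioid.baseObj F₁ A))) ≃
        Primes (Φ₂.obj (op (PreFrobenioid.baseObj F₂ (Ψ.functor.obj A))))),
      (∀ (A : C₁) (𝔭 : Primes (Φ₁.obj (op (PreFrobenioid.baseObj F₁ A)))),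
        (∀ ⦃B : C₁⦄ (φ : A ⟶ B), PreFrobenioid.IsCoAngularPreStep F₁ φ →
            (PreFrobenioid.Div F₁ φ ∈ 𝔭.submonoid ↔
              PreFrobenioid.Div F₂ (Ψ.functor.map φ) ∈ (e A 𝔭).submonoid)) ∧
        ∀ ⦃B : C₁⦄ (ψ : B ⟶ A), PreFrobenioid.IsCoAngularPreStep F₁ ψ →
          ((∃ y ∈ 𝔭.submonoid, pull Φ₁ (PreFrobenioid.Base F₁ ψ) y = PreFrobenioid.Div F₁ ψ) ↔
            ∃ y ∈ (e A 𝔭).submonoid, pull Φ₂ (PreFrobenioid.Base F₂ (Ψ.functor.map ψ)) y =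
              PreFrobenioid.Div F₂ (Ψ.functor.map ψ))) ∧
      (∀ ⦃A B : C₁⦄ (φ : A ⟶ B), PreFrobenioid.IsPreStep F₁ φ →
          E.iso A (PreFrobenioid.Div F₁ φ) = PreFrobenioid.Div F₂ (Ψ.functor.map φ)) ∧
      Literature.AlgebraicGeometry.Frobenioids.PreFrobenioidData.Thm49_compat
        (PreFrobenioidData.ofFunctor Φ₁ F₁) (PreFrobenioidData.ofFunctor Φ₂ F₂) Ψ E e := by
  refine exists_thm49_compat_of_cover_weak F₁ F₂ Ψ S (fun _ _ _ hφ => S.isPrimaryPreStep_map hφ)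
    (fun _ _ _ hφ => S.isPrimaryPreStep_inverse_map hφ) hdivid
    (PreFrobenioidData.IsStrictlyRational (PreFrobenioid.biratData S.isFrobenioid₁ hsq) Supp)
    (fun A' hA' 𝔮 => exists_twinPrimary_pair_of_isStrictlyRational_weak S.isFrobenioid₁ S.isFrobenioid₂
      S.perfect₁ S.perfect₂ S.isotropic₁ S.isotropic₂ S.perfFactorial₁ S.perfFactorial₂ S.preStep_map S.preStep_inv
      S.step_map (fun _ _ _ hφ => S.isPrimaryPreStep_map hφ) hdiveq hsq Supp hSupp hA' 𝔮)
    (fun A hA => ?_)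
  -- Def. 4.5 (ii): a pull-back morphism `A′ → A` from a strictly rational `A′`
  obtain ⟨A', ψ, hψ, hA'⟩ := hrat hA
  exact ⟨A', ψ, (PreFrobenioidData.ofFunctor_isPullbackMorphism F₁ ψ).mp hψ, hA'⟩

/-- (WEAK setting: `T42.SettingWeak`, weakly perf-factorial `Φ_i`; twin of the strong theorem of the same name without `_weak`; row T49-L02 consumed as `sufficesRightEqLeft_holds_weak`.) **[FrdI] Thm. 4.9 (with compatibility) at the perfections, `Φ₂` non-dilating, modulo row T49-L02
ALONE** (p. 89 l. 38 – p. 90 l. 54): as `exists_thm49_compat_of_isRational_weak`, with the two Thm. 4.2 inputs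
being the kernel theorems `SettingWeak.isDivIdentity_map_weak` (row T42-L11) and `SettingWeak.divEquivalent_map`
(Thm. 4.2 (ii) + "`Φ_i` non-dilating") — so that, in the setting of the proof with `Φ₂` non-dilating
(Def. 3.1 (i)(e), part of "standard type"), over print's hypotheses (a support predicate as in Def. 2.4 (i)(d);
every universally Div-Frobenius-trivial object rational at THE birationalization of Prop. 4.4, whose squares
exist in every Frobenioid, Prop. 1.11 (vii), `hasBiratSquares_of_isFrobenioid`), THE `Ψ^Prime` and an
isomorphism of functors
`Ψ^Φ : Φ₁ ⥲ Φ₂` over `Ψ` with the Div clause and `Thm49_compat` follow from row T49-L02.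
[cite: MochizukiFrdI2008, Thm. 4.9 p.89] -/
theorem exists_thm49_compat_of_isRational_of_nonDilating_weak
    (S : T42.SettingWeak F₁ F₂ Ψ) (hnd₂ : IsNonDilatingOn Φ₂)
    (Supp : ∀ {X : D₁}, (PreFrobenioidData.ofFunctor Φ₁ F₁).Mon X →
      Primes ((PreFrobenioidData.ofFunctor Φ₁ F₁).Mon X) → Prop)
    (hSupp : ∀ (X : D₁) (a : Φ₁.obj (op X)) (𝔭 : Primes (Φ₁.obj (op X))),
      Supp a 𝔭 ↔ ∃ (a₀ : Φ₁.obj (op X)) (h₀ : IsPrimary a₀),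
        Quotient.mk (primarySetoid _) ⟨a₀, h₀⟩ = 𝔭 ∧ Precsim a₀ a)
    (hrat : ∀ ⦃A : C₁⦄, PreFrobenioid.IsUniversallyDivFrobeniusTrivial F₁ A →
      PreFrobenioidData.IsRational (PreFrobenioid.biratData S.isFrobenioid₁
        (PreFrobenioid.hasBiratSquares_of_isFrobenioid S.isFrobenioid₁)) Supp A) :
    ∃ (E : PreFrobenioidData.DivisorMonoidIsoOver (PreFrobenioidData.ofFunctor Φ₁ F₁)
        (PreFrobenioidData.ofFunctor Φ₂ F₂) Ψ)
      (e : ∀ A : C₁, Primes (Φ₁.obj (op (PreFrobenioid.baseObj F₁ A))) ≃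
        Primes (Φ₂.obj (op (PreFrobenioid.baseObj F₂ (Ψ.functor.obj A))))),
      (∀ (A : C₁) (𝔭 : Primes (Φ₁.obj (op (PreFrobenioid.baseObj F₁ A)))),
        (∀ ⦃B : C₁⦄ (φ : A ⟶ B), PreFrobenioid.IsCoAngularPreStep F₁ φ →
            (PreFrobenioid.Div F₁ φ ∈ 𝔭.submonoid ↔
              PreFrobenioid.Div F₂ (Ψ.functor.map φ) ∈ (e A 𝔭).submonoid)) ∧
        ∀ ⦃B : C₁⦄ (ψ : B ⟶ A), PreFrobenioid.IsCoAngularPreStep F₁ ψ →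
          ((∃ y ∈ 𝔭.submonoid, pull Φ₁ (PreFrobenioid.Base F₁ ψ) y = PreFrobenioid.Div F₁ ψ) ↔
            ∃ y ∈ (e A 𝔭).submonoid, pull Φ₂ (PreFrobenioid.Base F₂ (Ψ.functor.map ψ)) y =
              PreFrobenioid.Div F₂ (Ψ.functor.map ψ))) ∧
      (∀ ⦃A B : C₁⦄ (φ : A ⟶ B), PreFrobenioid.IsPreStep F₁ φ →
          E.iso A (PreFrobenioid.Div F₁ φ) = PreFrobenioid.Div F₂ (Ψ.functor.map φ)) ∧
      Literature.AlgebraicGeometry.Frobenioids.PreFrobenioidData.Thm49_compat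
        (PreFrobenioidData.ofFunctor Φ₁ F₁) (PreFrobenioidData.ofFunctor Φ₂ F₂) Ψ E e :=
  exists_thm49_compat_of_isRational_weak S (fun _ _ α hα => S.isDivIdentity_map hnd₂ α hα)
    (fun _ _ φ ψ hφ hψ h => S.divEquivalent_map hnd₂ φ ψ hφ hψ h)
    (PreFrobenioid.hasBiratSquares_of_isFrobenioid S.isFrobenioid₁) Supp hSupp hrat

/-- (WEAK setting: `T42.SettingWeak`, weakly perf-factorial `Φ_i`; twin of the strong theorem of the same name without `_weak`; row T49-L02 consumed as `sufficesRightEqLeft_holds_weak`.) **[FrdI] Thm. 4.9 WITH its compatibility clause, at the perfections — UNCONDITIONAL over print's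
hypotheses** (statement p. 88 l. 33 – p. 89 l. 2; proof p. 89 l. 3 – p. 90 l. 54): in the setting of the proof
of Thm. 4.2 (`T42.SettingWeak`: Frobenioids of PERFECT and isotropic type — "after passing to the perfections" —
`Φ_i` perf-factorial, the Thm. 3.4 (ii)(iii) transports) with `Φ₂` non-dilating (Def. 3.1 (i)(e)), a support
predicate `Supp` on the `Φ₁(X)` obeying the support axiom of Def. 2.4 (i)(d), and every universally
Div-Frobenius-trivial object of `C₁` rational at THE birationalization (Def. 4.5 (ii)(iii): "rationally
standard type"), there exist THE `Ψ^Prime` of Thm. 4.2 (ii) (clauses (a), (b)) and an isomorphism of functors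
`Ψ^Φ : Φ₁ ⥲ Φ₂` lying over `Ψ` (the closing shape `DivisorMonoidIsoOver` of the typed `Thm49`) computing
`Div(Ψ φ) = Ψ^Φ_A(Div φ)` on pre-steps and satisfying the typed compatibility clause `Thm49_compat`. All rows
of the S5 sub-DAG of Thm. 4.9 enter BY NAME: T49-L02 `sufficesRightEqLeft_holds` (seat abc-iut-w4-d035),
L05 (abc-iut-w4-d109), L06/L08′ (abc-iut-w4-d105), L07 (abc-iut-w5-d021), the right = left gluing and the
Div-equivalence transport (abc-iut-w4-d099), T42-L04–L11 (abc-iut-w4-d099 / abc-iut-w4-d068 / abc-iut-w5-d162).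
[cite: MochizukiFrdI2008, Thm. 4.9 p.88] -/
theorem exists_thm49_compat_perfect_weak (S : T42.SettingWeak F₁ F₂ Ψ) (hnd₂ : IsNonDilatingOn Φ₂)
    (Supp : ∀ {X : D₁}, (PreFrobenioidData.ofFunctor Φ₁ F₁).Mon X →
      Primes ((PreFrobenioidData.ofFunctor Φ₁ F₁).Mon X) → Prop)
    (hSupp : ∀ (X : D₁) (a : Φ₁.obj (op X)) (𝔭 : Primes (Φ₁.obj (op X))),
      Supp a 𝔭 ↔ ∃ (a₀ : Φ₁.obj (op X)) (h₀ : IsPrimary a₀),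
        Quotient.mk (primarySetoid _) ⟨a₀, h₀⟩ = 𝔭 ∧ Precsim a₀ a)
    (hrat : ∀ ⦃A : C₁⦄, PreFrobenioid.IsUniversallyDivFrobeniusTrivial F₁ A →
      PreFrobenioidData.IsRational (PreFrobenioid.biratData S.isFrobenioid₁
        (PreFrobenioid.hasBiratSquares_of_isFrobenioid S.isFrobenioid₁)) Supp A) :
    ∃ (E : PreFrobenioidData.DivisorMonoidIsoOver (PreFrobenioidData.ofFunctor Φ₁ F₁)
        (PreFrobenioidData.ofFunctor Φ₂ F₂) Ψ)
      (e : ∀ A : C₁, Primes (Φ₁.obj (op (PreFrobenioid.baseObj F₁ A))) ≃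
        Primes (Φ₂.obj (op (PreFrobenioid.baseObj F₂ (Ψ.functor.obj A))))),
      (∀ (A : C₁) (𝔭 : Primes (Φ₁.obj (op (PreFrobenioid.baseObj F₁ A)))),
        (∀ ⦃B : C₁⦄ (φ : A ⟶ B), PreFrobenioid.IsCoAngularPreStep F₁ φ →
            (PreFrobenioid.Div F₁ φ ∈ 𝔭.submonoid ↔
              PreFrobenioid.Div F₂ (Ψ.functor.map φ) ∈ (e A 𝔭).submonoid)) ∧
        ∀ ⦃B : C₁⦄ (ψ : B ⟶ A), PreFrobenioid.IsCoAngularPreStep F₁ ψ →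
          ((∃ y ∈ 𝔭.submonoid, pull Φ₁ (PreFrobenioid.Base F₁ ψ) y = PreFrobenioid.Div F₁ ψ) ↔
            ∃ y ∈ (e A 𝔭).submonoid, pull Φ₂ (PreFrobenioid.Base F₂ (Ψ.functor.map ψ)) y =
              PreFrobenioid.Div F₂ (Ψ.functor.map ψ))) ∧
      (∀ ⦃A B : C₁⦄ (φ : A ⟶ B), PreFrobenioid.IsPreStep F₁ φ →
          E.iso A (PreFrobenioid.Div F₁ φ) = PreFrobenioid.Div F₂ (Ψ.functor.map φ)) ∧
      Literature.AlgebraicGeometry.Frobenioids.PreFrobenioidData.Thm49_compat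
        (PreFrobenioidData.ofFunctor Φ₁ F₁) (PreFrobenioidData.ofFunctor Φ₂ F₂) Ψ E e :=
  exists_thm49_compat_of_isRational_of_nonDilating_weak S hnd₂ Supp hSupp hrat

/-- (WEAK setting: `T42.SettingWeak`, weakly perf-factorial `Φ_i`; twin of the strong theorem of the same name without `_weak`; row T49-L02 consumed as `sufficesRightEqLeft_holds_weak`.) **The same at THE support predicate of Def. 2.4 (i)(d)** (`PrimarySupp a 𝔭`: "some primary element of
the class `𝔭` is `≼ a`" — the shape in which Prop. 5.5 (iii) transfers rationality to the perfection,
`Perfection.isRational_perfection_of`, seats abc-iut-w5-d042 / abc-iut-w4-d108): the support axiom binder is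
then `Iff.rfl`, so Thm. 4.9 WITH compatibility at the perfections carries exactly two hypotheses beyond the
`T42.SettingWeak` — `Φ₂` non-dilating and "every universally Div-Frobenius-trivial object is rational".
[cite: MochizukiFrdI2008, Thm. 4.9 p.88] -/
theorem exists_thm49_compat_perfect_primarySupp_weak (S : T42.SettingWeak F₁ F₂ Ψ) (hnd₂ : IsNonDilatingOn Φ₂)
    (hrat : ∀ ⦃A : C₁⦄, PreFrobenioid.IsUniversallyDivFrobeniusTrivial F₁ A →
      PreFrobenioidData.IsRational (PreFrobenioid.biratData S.isFrobenioid₁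
        (PreFrobenioid.hasBiratSquares_of_isFrobenioid S.isFrobenioid₁))
        (S := PreFrobenioidData.ofFunctor Φ₁ F₁) (fun a 𝔭 => PrimarySupp a 𝔭) A) :
    ∃ (E : PreFrobenioidData.DivisorMonoidIsoOver (PreFrobenioidData.ofFunctor Φ₁ F₁)
        (PreFrobenioidData.ofFunctor Φ₂ F₂) Ψ)
      (e : ∀ A : C₁, Primes (Φ₁.obj (op (PreFrobenioid.baseObj F₁ A))) ≃
        Primes (Φ₂.obj (op (PreFrobenioid.baseObj F₂ (Ψ.functor.obj A))))),
      (∀ (A : C₁) (𝔭 : Primes (Φ₁.obj (op (PreFrobenioid.baseObj F₁ A)))),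
        (∀ ⦃B : C₁⦄ (φ : A ⟶ B), PreFrobenioid.IsCoAngularPreStep F₁ φ →
            (PreFrobenioid.Div F₁ φ ∈ 𝔭.submonoid ↔
              PreFrobenioid.Div F₂ (Ψ.functor.map φ) ∈ (e A 𝔭).submonoid)) ∧
        ∀ ⦃B : C₁⦄ (ψ : B ⟶ A), PreFrobenioid.IsCoAngularPreStep F₁ ψ →
          ((∃ y ∈ 𝔭.submonoid, pull Φ₁ (PreFrobenioid.Base F₁ ψ) y = PreFrobenioid.Div F₁ ψ) ↔
            ∃ y ∈ (e A 𝔭).submonoid, pull Φ₂ (PreFrobenioid.Base F₂ (Ψ.functor.map ψ)) y =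
              PreFrobenioid.Div F₂ (Ψ.functor.map ψ))) ∧
      (∀ ⦃A B : C₁⦄ (φ : A ⟶ B), PreFrobenioid.IsPreStep F₁ φ →
          E.iso A (PreFrobenioid.Div F₁ φ) = PreFrobenioid.Div F₂ (Ψ.functor.map φ)) ∧
      Literature.AlgebraicGeometry.Frobenioids.PreFrobenioidData.Thm49_compat
        (PreFrobenioidData.ofFunctor Φ₁ F₁) (PreFrobenioidData.ofFunctor Φ₂ F₂) Ψ E e :=
  exists_thm49_compat_perfect_weak S hnd₂ (fun a 𝔭 => PrimarySupp a 𝔭) (fun _ _ _ => Iff.rfl) hrat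

end FrdI.T49

end Literature.AlgebraicGeometry.Frobenioids
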